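import Summits.QuantumFields.BalabanUV.T4Continuum.Support.NE7K1LinWalkLineBlocks
import Summits.QuantumFields.BalabanUV.T4Continuum.Support.NE7K1LinWalkLineCoarse

/-!
# NE7K1LinWalkLineHcomm — row NE7 (node U5), candidate route HOM, path H1L, cell K1-lin(s): (H-comm) FOR THE ψ-RESCALED TWO-CUTOFF
# OPERATOR `𝒫♮(s)` — `‖[diag(λ∘site), 𝒫♮(s)]w‖² ≤ α♮·⟨w, 𝒫♮(s)w⟩ + β♮·‖w‖²`, `α♮, β♮` built from the three oscillation numbers of the
# coarse cut-off `λ` (bond `ℓ₁`, Neumann second difference `ℓ₂`, `n`-block `ℓ₃`), FREE OF `s`, and mesh-free for `ℓ₁ ~ 1∕(Mn)`,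
# `ℓ₂ ~ 1∕(Mn)²`, `ℓ₃ ~ 1∕M`

Lineage `b2b-balaban-t4-ne7-p2` (CRUX PROVER NE7 #2), generation 69; series (RW) file 13 — the ESTIMATE that `NE7K1LinWalkLine` (g68,
file 9) left to the successor, over `NE7K1LinWalkLineBlocks` (file 12: off-diagonal blocks), `NE7K1LinWalkLineCoarse.comm_mulVec_sq_le_runB₁₁`
(g68, file 10), `NE7K1LinWalkCommutator.comm_mulVec_sq_le_fineOpR` (file 4), `NE7K1LinWalkLine.extLine_form ∕ runB_form_ge_runA ∕
runB_form_ge_fluct`, `NE7K1LinRunBScales.trial_form_le`; route via BLOCK ENTRIES `[[(1−s)[λ,P_A] + s[λ,B₁₁], √sμ[Λ,B]₁₂], [√sμ[Λ,B]₂₁, μ²[Λ,B]₂₂]]`.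
* §4 **`comm_extLine_sq_le`**: for `a > 0`, `n ≥ 1`, `R′` a union of `nL`-blocks, `s ∈ [0,1]`:
  `‖[diag(λ∘site), 𝒫♮(s)]w‖² ≤ α♮⟨w,𝒫♮(s)w⟩ + β♮‖w‖²`, `α♮ = 2(12(d+1)n²ℓ₁² + L²·12(d+1)Ln²ℓ₁²)`,
  `β♮ = 2(3((n²ℓ₂)² + a²ℓ₃²) + 3((Ln²ℓ₂)² + a²ℓ₃²)) + 2θ²(μ²D + μ⁴D′)`, `θ = ℓ₁·8(d+1)(nL)²∕L^{d+1}`, `D = 4(d+1)²L^{d+1}`,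
  `D′ = 4(d+1)²L^{2(d+1)}` — every `n` comes paired as `nℓ₁` or `n²ℓ₂`: mesh-free on the scale of `M` blocks (file 14 instantiates).

HONEST FRAMING: [folklore] finite linear algebra at the Gaussian `A = 0` level; crude constants; nothing of Bałaban's asserted; no `sorry`.
Census only (the LINE's walk expansion is assembled in file 14); NO letter ∕ tag ∕ size of NE7 moves; NE7 NOT PRINTED ∕ NOT PROVED;
spine 0∕9; FIXED FINITE T⁴, rung (B)+1; NOT infinite volume, NOT mass gap, NOT Clay.  HONEST DEPENDENCY: continuum YM on T⁴ ⇐ BetaPertH ∧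
nine spine estimates (0/9 proved); BetaPertH ⇐ (D1) ∧ (D4) ∧ CAP+tail; G-an2-4 gates asym, D1 and NE2/3/4.
-/

noncomputable section

open Finset Matrix

namespace Summit.QuantumFields.BalabanUV.T4Continuum.NE7K1LinWalkLineHcomm

open Literature.MathematicalPhysics.QuantumFieldTheory.Balaban1983to89
open Literature.MathematicalPhysics.QuantumFieldTheory.Balaban1983to89.B4Reflection242
open Literature.MathematicalPhysics.QuantumFieldTheory.Balaban1983to89.B4BoxCov237
open Literature.MathematicalPhysics.QuantumFieldTheory.Balaban1983to89.B4Lower18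
open NE7K1LinSchurLineForm NE7K1LinSchurLineCoords NE7K1LinBlockCoords NE7K1LinSchurLineU1 NE7K1LinSchurLineU1Sharp NE7K1LinTwoRunKit
  NE7K1LinTwoRunUpper NE7K1LinRunBScales NE7K1LinWalkParametrix NE7K1LinWalkCommutator NE7K1LinWalkLine NE7K1LinWalkLineCoarse
  NE7K1LinWalkLineEntries NE7K1LinWalkLineBlocks

variable {d : ℕ} {n L : ℕ} [NeZero L] {R' : Finset (Fin (d + 1) → ℤ)}

/-! ### §1 The blocks of `𝒫♮(s)` entrywise and the commutator row by row -/

section Entries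

variable (hR'L : IsBlockUnion L R') (n : ℕ) (a s : ℝ)

/-- the `(1,1)` entries of `𝒫♮(s)`: `(1−s)P_A + s(H_B)₁₁`. [folklore] -/
theorem extLine_apply_inl_inl (b b' : ↥(R'.image (blk L))) :
    extLine hR'L n a s (Sum.inl b) (Sum.inl b') = (1 - s) * runA n L a R' b b' + s * runB hR'L n a (Sum.inl b) (Sum.inl b') := by
  obtain ⟨h11, -, -, -⟩ := runBμ_blocks hR'L n a (1 / (n : ℝ))
  rw [extLine, extOpR, fromBlocks_apply₁₁, Matrix.add_apply, Matrix.smul_apply, Matrix.smul_apply, h11]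
  rfl

/-- the `(1,2)` entries of `𝒫♮(s)`: `√s·μ·(H_B)₁₂`, `μ = 1∕n`. [folklore] -/
theorem extLine_apply_inl_inr (b : ↥(R'.image (blk L))) (q : ↥(R'.image (blk L)) × NZ d L) :
    extLine hR'L n a s (Sum.inl b) (Sum.inr q) = Real.sqrt s * ((1 / (n : ℝ)) * runB hR'L n a (Sum.inl b) (Sum.inr q)) := by
  obtain ⟨-, h12, -, -⟩ := runBμ_blocks hR'L n a (1 / (n : ℝ))
  rw [extLine, extOpR, fromBlocks_apply₁₂, Matrix.smul_apply, h12, Matrix.smul_apply]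
  rfl

/-- the `(2,1)` entries of `𝒫♮(s)`: `√s·μ·(H_B)₂₁`. [folklore] -/
theorem extLine_apply_inr_inl (p : ↥(R'.image (blk L)) × NZ d L) (b' : ↥(R'.image (blk L))) :
    extLine hR'L n a s (Sum.inr p) (Sum.inl b') = Real.sqrt s * ((1 / (n : ℝ)) * runB hR'L n a (Sum.inr p) (Sum.inl b')) := by
  obtain ⟨-, -, h21, -⟩ := runBμ_blocks hR'L n a (1 / (n : ℝ))
  rw [extLine, extOpR, fromBlocks_apply₂₁, Matrix.smul_apply, h21, Matrix.smul_apply]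
  rfl

/-- the `(2,2)` entries of `𝒫♮(s)`: `μ²·(H_B)₂₂`. [folklore] -/
theorem extLine_apply_inr_inr (p q : ↥(R'.image (blk L)) × NZ d L) :
    extLine hR'L n a s (Sum.inr p) (Sum.inr q) = (1 / (n : ℝ)) ^ 2 * runB hR'L n a (Sum.inr p) (Sum.inr q) := by
  obtain ⟨-, -, -, h22⟩ := runBμ_blocks hR'L n a (1 / (n : ℝ))
  rw [extLine, extOpR, fromBlocks_apply₂₂, h22, Matrix.smul_apply]
  rfl

/-- `[diag(λ∘site), H_B]₁₁ = [diag λ, (H_B)₁₁]`. [folklore] -/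
theorem toBlocks₁₁_comm (lam : ↥(R'.image (blk L)) → ℝ) :
    (comm (fun c : Idx L R' => lam (site c)) (runB hR'L n a)).toBlocks₁₁ =
      diagonal lam * (runB hR'L n a).toBlocks₁₁ - (runB hR'L n a).toBlocks₁₁ * diagonal lam := by
  ext b b'
  rw [toBlocks₁₁, of_apply, comm_apply, Matrix.sub_apply, diagonal_mul, mul_diagonal, toBlocks₁₁, of_apply]
  simp only [site]
  ring

/-- **THE COARSE ROWS OF THE COMMUTATOR**: `([Λ,𝒫♮(s)]w)_b = (1−s)([λ,P_A]a)_b + s([λ,B₁₁]a)_b + √sμ([Λ,B]₁₂ψ)_b`, `w = (a,ψ)`. [folklore] -/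
theorem comm_extLine_mulVec_inl (lam : ↥(R'.image (blk L)) → ℝ) (w : Idx L R' → ℝ) (b : ↥(R'.image (blk L))) :
    (comm (fun c : Idx L R' => lam (site c)) (extLine hR'L n a s) *ᵥ w) (Sum.inl b) =
      (1 - s) * (comm lam (runA n L a R') *ᵥ (w ∘ Sum.inl)) b +
        s * ((comm (fun c : Idx L R' => lam (site c)) (runB hR'L n a)).toBlocks₁₁ *ᵥ (w ∘ Sum.inl)) b +
          Real.sqrt s * (1 / (n : ℝ)) * ((comm (fun c : Idx L R' => lam (site c)) (runB hR'L n a)).toBlocks₁₂ *ᵥ (w ∘ Sum.inr)) b := by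
  have h1 : ∀ b' : ↥(R'.image (blk L)),
      comm (fun c : Idx L R' => lam (site c)) (extLine hR'L n a s) (Sum.inl b) (Sum.inl b') * w (Sum.inl b') =
        (1 - s) * ((lam b - lam b') * runA n L a R' b b' * w (Sum.inl b')) +
          s * ((lam b - lam b') * runB hR'L n a (Sum.inl b) (Sum.inl b') * w (Sum.inl b')) := by
    intro b'; rw [comm_apply, extLine_apply_inl_inl]; simp only [site]; ring
  have h2 : ∀ q : ↥(R'.image (blk L)) × NZ d L,
      comm (fun c : Idx L R' => lam (site c)) (extLine hR'L n a s) (Sum.inl b) (Sum.inr q) * w (Sum.inr q) =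
        Real.sqrt s * (1 / (n : ℝ)) * ((lam b - lam q.1) * runB hR'L n a (Sum.inl b) (Sum.inr q) * w (Sum.inr q)) := by
    intro q; rw [comm_apply, extLine_apply_inl_inr]; simp only [site]; ring
  rw [mulVec, dotProduct, Fintype.sum_sum_type]
  simp_rw [h1, h2]
  rw [Finset.sum_add_distrib, ← Finset.mul_sum, ← Finset.mul_sum, ← Finset.mul_sum]
  simp only [mulVec, dotProduct, toBlocks₁₁, toBlocks₁₂, of_apply, comm_apply, Function.comp_apply, site]

/-- **THE FLUCTUATION ROWS OF THE COMMUTATOR**: `([Λ,𝒫♮(s)]w)_p = √sμ([Λ,B]₂₁a)_p + μ²([Λ,B]₂₂ψ)_p`. [folklore] -/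
theorem comm_extLine_mulVec_inr (lam : ↥(R'.image (blk L)) → ℝ) (w : Idx L R' → ℝ) (p : ↥(R'.image (blk L)) × NZ d L) :
    (comm (fun c : Idx L R' => lam (site c)) (extLine hR'L n a s) *ᵥ w) (Sum.inr p) =
      Real.sqrt s * (1 / (n : ℝ)) * ((comm (fun c : Idx L R' => lam (site c)) (runB hR'L n a)).toBlocks₂₁ *ᵥ (w ∘ Sum.inl)) p +
        (1 / (n : ℝ)) ^ 2 * ((comm (fun c : Idx L R' => lam (site c)) (runB hR'L n a)).toBlocks₂₂ *ᵥ (w ∘ Sum.inr)) p := by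
  have h1 : ∀ b' : ↥(R'.image (blk L)),
      comm (fun c : Idx L R' => lam (site c)) (extLine hR'L n a s) (Sum.inr p) (Sum.inl b') * w (Sum.inl b') =
        Real.sqrt s * (1 / (n : ℝ)) * ((lam p.1 - lam b') * runB hR'L n a (Sum.inr p) (Sum.inl b') * w (Sum.inl b')) := by
    intro b'; rw [comm_apply, extLine_apply_inr_inl]; simp only [site]; ring
  have h2 : ∀ q : ↥(R'.image (blk L)) × NZ d L,
      comm (fun c : Idx L R' => lam (site c)) (extLine hR'L n a s) (Sum.inr p) (Sum.inr q) * w (Sum.inr q) =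
        (1 / (n : ℝ)) ^ 2 * ((lam p.1 - lam q.1) * runB hR'L n a (Sum.inr p) (Sum.inr q) * w (Sum.inr q)) := by
    intro q; rw [comm_apply, extLine_apply_inr_inr]; simp only [site]; ring
  rw [mulVec, dotProduct, Fintype.sum_sum_type]
  simp_rw [h1, h2]
  rw [← Finset.mul_sum, ← Finset.mul_sum]
  simp only [mulVec, dotProduct, toBlocks₂₁, toBlocks₂₂, of_apply, comm_apply, Function.comp_apply, site]

end Entries

/-! ### §2 Row sums: convexity in `s` and the split of squares -/

/-- `((1−s)p + sq + r)² ≤ 2((1−s)p² + sq²) + 2r²` for `s ∈ [0,1]` (convexity of the square, then `(x+r)² ≤ 2x² + 2r²`). [folklore] -/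
theorem sq_convex_add_le {s p q r : ℝ} (hs0 : 0 ≤ s) (hs1 : s ≤ 1) :
    ((1 - s) * p + s * q + r) ^ 2 ≤ 2 * ((1 - s) * p ^ 2 + s * q ^ 2) + 2 * r ^ 2 := by
  have h1 : ((1 - s) * p + s * q) ^ 2 ≤ (1 - s) * p ^ 2 + s * q ^ 2 := by
    nlinarith [sq_nonneg (p - q), mul_nonneg hs0 (sub_nonneg.2 hs1)]
  nlinarith [sq_nonneg ((1 - s) * p + s * q - r), h1]

section Rows

variable (hR'L : IsBlockUnion L R') (n : ℕ) (a : ℝ) {s : ℝ} (hs0 : 0 ≤ s) (hs1 : s ≤ 1)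

include hs0 hs1 in
/-- **THE COARSE ROWS, SQUARED AND SUMMED**: `Σ_b([Λ,𝒫♮]w)_b² ≤ 2(1−s)‖[λ,P_A]a‖² + 2s‖[λ,B₁₁]a‖² + 2sμ²‖[Λ,B]₁₂ψ‖²`. [folklore] -/
theorem comm_extLine_inl_sq_le (lam : ↥(R'.image (blk L)) → ℝ) (w : Idx L R' → ℝ) :
    ∑ b : ↥(R'.image (blk L)), (comm (fun c : Idx L R' => lam (site c)) (extLine hR'L n a s) *ᵥ w) (Sum.inl b) ^ 2 ≤
      2 * (1 - s) * (comm lam (runA n L a R') *ᵥ (w ∘ Sum.inl) ⬝ᵥ comm lam (runA n L a R') *ᵥ (w ∘ Sum.inl)) +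
        2 * s * ((comm (fun c : Idx L R' => lam (site c)) (runB hR'L n a)).toBlocks₁₁ *ᵥ (w ∘ Sum.inl) ⬝ᵥ
          (comm (fun c : Idx L R' => lam (site c)) (runB hR'L n a)).toBlocks₁₁ *ᵥ (w ∘ Sum.inl)) +
        2 * (s * (1 / (n : ℝ)) ^ 2) * ((comm (fun c : Idx L R' => lam (site c)) (runB hR'L n a)).toBlocks₁₂ *ᵥ (w ∘ Sum.inr) ⬝ᵥ
          (comm (fun c : Idx L R' => lam (site c)) (runB hR'L n a)).toBlocks₁₂ *ᵥ (w ∘ Sum.inr)) := by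
  have hss : Real.sqrt s ^ 2 = s := Real.sq_sqrt hs0
  simp_rw [comm_extLine_mulVec_inl]
  set u₁ := comm lam (runA n L a R') *ᵥ (w ∘ Sum.inl) with hu₁
  set u₂ := (comm (fun c : Idx L R' => lam (site c)) (runB hR'L n a)).toBlocks₁₁ *ᵥ (w ∘ Sum.inl) with hu₂
  set u₃ := (comm (fun c : Idx L R' => lam (site c)) (runB hR'L n a)).toBlocks₁₂ *ᵥ (w ∘ Sum.inr) with hu₃
  have hpt : ∀ b, ((1 - s) * u₁ b + s * u₂ b + Real.sqrt s * (1 / (n : ℝ)) * u₃ b) ^ 2 ≤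
      2 * ((1 - s) * u₁ b ^ 2 + s * u₂ b ^ 2) + 2 * (Real.sqrt s * (1 / (n : ℝ)) * u₃ b) ^ 2 := fun b =>
    sq_convex_add_le hs0 hs1
  refine (Finset.sum_le_sum fun b _ => hpt b).trans (le_of_eq ?_)
  simp only [dotProduct, Finset.mul_sum, ← Finset.sum_add_distrib]
  refine Finset.sum_congr rfl fun b _ => ?_
  rw [mul_pow, mul_pow, hss]
  ring

include hs0 in
/-- **THE FLUCTUATION ROWS, SQUARED AND SUMMED**: `Σ_p([Λ,𝒫♮]w)_p² ≤ 2sμ²‖[Λ,B]₂₁a‖² + 2μ⁴‖[Λ,B]₂₂ψ‖²`. [folklore] -/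
theorem comm_extLine_inr_sq_le (lam : ↥(R'.image (blk L)) → ℝ) (w : Idx L R' → ℝ) :
    ∑ p : ↥(R'.image (blk L)) × NZ d L, (comm (fun c : Idx L R' => lam (site c)) (extLine hR'L n a s) *ᵥ w) (Sum.inr p) ^ 2 ≤
      2 * (s * (1 / (n : ℝ)) ^ 2) * ((comm (fun c : Idx L R' => lam (site c)) (runB hR'L n a)).toBlocks₂₁ *ᵥ (w ∘ Sum.inl) ⬝ᵥ
          (comm (fun c : Idx L R' => lam (site c)) (runB hR'L n a)).toBlocks₂₁ *ᵥ (w ∘ Sum.inl)) +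
        2 * ((1 / (n : ℝ)) ^ 2) ^ 2 * ((comm (fun c : Idx L R' => lam (site c)) (runB hR'L n a)).toBlocks₂₂ *ᵥ (w ∘ Sum.inr) ⬝ᵥ
          (comm (fun c : Idx L R' => lam (site c)) (runB hR'L n a)).toBlocks₂₂ *ᵥ (w ∘ Sum.inr)) := by
  have hss : Real.sqrt s ^ 2 = s := Real.sq_sqrt hs0
  simp_rw [comm_extLine_mulVec_inr]
  set u₄ := (comm (fun c : Idx L R' => lam (site c)) (runB hR'L n a)).toBlocks₂₁ *ᵥ (w ∘ Sum.inl) with hu₄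
  set u₅ := (comm (fun c : Idx L R' => lam (site c)) (runB hR'L n a)).toBlocks₂₂ *ᵥ (w ∘ Sum.inr) with hu₅
  -- `(p+q)² ≤ 2p² + 2q²` (the tree's `RotorChain.add_sq_le_two_mul`, not imported for one line)
  have h2 : ∀ p q : ℝ, (p + q) ^ 2 ≤ 2 * p ^ 2 + 2 * q ^ 2 := fun p q => by nlinarith [sq_nonneg (p - q)]
  refine (Finset.sum_le_sum fun p _ => h2 _ _).trans (le_of_eq ?_)
  simp only [dotProduct, Finset.mul_sum, ← Finset.sum_add_distrib]
  refine Finset.sum_congr rfl fun p _ => ?_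
  rw [mul_pow, mul_pow, mul_pow, hss]
  ring

end Rows

/-! ### §3 Form comparisons -/

section Forms

variable (hn : 1 ≤ n) (hR' : IsBlockUnion (n * L) R') {a : ℝ} (ha : 0 < a) {s : ℝ} (hs0 : 0 ≤ s) (hs1 : s ≤ 1)

/-- the form of the coarse block: `⟨v,(H_B)₁₁v⟩ = ⟨(v,0),H_B(v,0)⟩`. [folklore] -/
theorem toBlocks₁₁_form (hR'L : IsBlockUnion L R') (v : ↥(R'.image (blk L)) → ℝ) :
    v ⬝ᵥ (runB hR'L n a).toBlocks₁₁ *ᵥ v =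
      Sum.elim v (0 : ↥(R'.image (blk L)) × NZ d L → ℝ) ⬝ᵥ (runB hR'L n a) *ᵥ (Sum.elim v 0) := by
  conv_rhs => rw [← fromBlocks_toBlocks (runB hR'L n a)]
  simp only [fromBlocks_mulVec, Sum.elim_comp_inl, Sum.elim_comp_inr, mulVec_zero, add_zero, sumElim_dotProduct_sumElim,
    zero_dotProduct]

include hn hR' ha hs0 in
/-- **THE COARSE BLOCK'S FORM AGAINST THE LINE'S**: `s·⟨a,(H_B)₁₁a⟩ ≤ L²·⟨(√s a, ψ∕n), H_B(√s a, ψ∕n)⟩` for every `ψ` (`trial_form_le`: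
`⟨(a,0),H_B(a,0)⟩ ≤ L²⟨a,P_Aa⟩`; Jensen `runB_form_ge_runA`: `⟨√s a, P_A √s a⟩ ≤ ⟨u, H_Bu⟩`). [folklore] -/
theorem runB₁₁_form_le (av : ↥(R'.image (blk L)) → ℝ) (ψ : ↥(R'.image (blk L)) × NZ d L → ℝ) :
    s * (av ⬝ᵥ (runB (isBlockUnion_fine hR') n a).toBlocks₁₁ *ᵥ av) ≤
      (L : ℝ) ^ 2 * (Sum.elim (Real.sqrt s • av) ((1 / (n : ℝ)) • ψ) ⬝ᵥ
        (runB (isBlockUnion_fine hR') n a) *ᵥ (Sum.elim (Real.sqrt s • av) ((1 / (n : ℝ)) • ψ))) := by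
  have hR'L : IsBlockUnion L R' := isBlockUnion_fine hR'
  have hss : Real.sqrt s * Real.sqrt s = s := Real.mul_self_sqrt hs0
  have h1 := trial_form_le hn hR' ha.le av
  rw [← toBlocks₁₁_form] at h1
  have h2 := runB_form_ge_runA hn hR' ha (Real.sqrt s • av) ((1 / (n : ℝ)) • ψ)
  have h3 : (Real.sqrt s • av) ⬝ᵥ (runA n L a R').mulVec (Real.sqrt s • av) = s * (av ⬝ᵥ (runA n L a R') *ᵥ av) := by
    rw [mulVec_smul, smul_dotProduct, dotProduct_smul, smul_eq_mul, smul_eq_mul, ← mul_assoc, hss]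
  rw [h3] at h2
  have hL2 : (0 : ℝ) ≤ (L : ℝ) ^ 2 := by positivity
  calc s * (av ⬝ᵥ (runB hR'L n a).toBlocks₁₁ *ᵥ av) ≤ s * ((L : ℝ) ^ 2 * (av ⬝ᵥ (runA n L a R') *ᵥ av)) :=
        mul_le_mul_of_nonneg_left h1 hs0
    _ = (L : ℝ) ^ 2 * (s * (av ⬝ᵥ (runA n L a R') *ᵥ av)) := by ring
    _ ≤ (L : ℝ) ^ 2 * (Sum.elim (Real.sqrt s • av) ((1 / (n : ℝ)) • ψ) ⬝ᵥ
          (runB hR'L n a) *ᵥ (Sum.elim (Real.sqrt s • av) ((1 / (n : ℝ)) • ψ))) := mul_le_mul_of_nonneg_left h2 hL2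

include hn hR' ha hs0 in
/-- **THE LINE'S FORM SPLIT**: `⟨w,𝒫♮(s)w⟩ = (1−s)⟨a,P_Aa⟩ + ⟨u,H_Bu⟩`, `u = (√s a, ψ∕n)`, with `0 ≤ ⟨a,P_Aa⟩` and `0 ≤ ⟨u,H_Bu⟩`. [folklore] -/
theorem extLine_form_split (w : Idx L R' → ℝ) :
    w ⬝ᵥ (extLine (isBlockUnion_fine hR') n a s) *ᵥ w =
      (1 - s) * ((w ∘ Sum.inl) ⬝ᵥ (runA n L a R') *ᵥ (w ∘ Sum.inl)) +
        Sum.elim (Real.sqrt s • (w ∘ Sum.inl)) ((1 / (n : ℝ)) • (w ∘ Sum.inr)) ⬝ᵥ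
          (runB (isBlockUnion_fine hR') n a) *ᵥ (Sum.elim (Real.sqrt s • (w ∘ Sum.inl)) ((1 / (n : ℝ)) • (w ∘ Sum.inr))) ∧
      0 ≤ (w ∘ Sum.inl) ⬝ᵥ (runA n L a R') *ᵥ (w ∘ Sum.inl) ∧
      0 ≤ Sum.elim (Real.sqrt s • (w ∘ Sum.inl)) ((1 / (n : ℝ)) • (w ∘ Sum.inr)) ⬝ᵥ
          (runB (isBlockUnion_fine hR') n a) *ᵥ (Sum.elim (Real.sqrt s • (w ∘ Sum.inl)) ((1 / (n : ℝ)) • (w ∘ Sum.inr))) := by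
  have hR'L : IsBlockUnion L R' := isBlockUnion_fine hR'
  refine ⟨extLine_form hR'L n a hs0 w, ?_, ?_⟩
  · have h := lower18_zero hn ha.le (isBlockUnion_coarse NeZero.one_le hR') (w ∘ Sum.inl)
    have h0 : 0 ≤ (w ∘ Sum.inl) ⬝ᵥ (w ∘ Sum.inl) := Finset.sum_nonneg fun i _ => mul_self_nonneg _
    exact le_trans (mul_nonneg (le_min zero_le_two ha.le) h0) h
  · have h := runB_form_ge_fluct hn hR' ha.le (Real.sqrt s • (w ∘ Sum.inl)) ((1 / (n : ℝ)) • (w ∘ Sum.inr))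
    have h0 : 0 ≤ ((1 / (n : ℝ)) • (w ∘ Sum.inr)) ⬝ᵥ ((1 / (n : ℝ)) • (w ∘ Sum.inr)) :=
      Finset.sum_nonneg fun i _ => mul_self_nonneg _
    exact le_trans (by positivity) h

end Forms

/-! ### §4 The (H-comm) estimate for `𝒫♮(s)` -/

section Hcomm

variable (hn : 1 ≤ n) (hR' : IsBlockUnion (n * L) R') {a : ℝ} (ha : 0 < a) {s : ℝ} (hs0 : 0 ≤ s) (hs1 : s ≤ 1)
  (lam : ↥(R'.image (blk L)) → ℝ) {ℓ₁ ℓ₂ ℓ₃ : ℝ} (hℓ₁ : 0 ≤ ℓ₁) (hℓ₃ : 0 ≤ ℓ₃)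
  (hbond : ∀ x y : ↥(R'.image (blk L)), y.1 ∈ nbrs x.1 → |lam x - lam y| ≤ ℓ₁)
  (hlap : ∀ x : ↥(R'.image (blk L)), |∑ y ∈ univ.filter (fun y : ↥(R'.image (blk L)) => y.1 ∈ nbrs x.1), (lam x - lam y)| ≤ ℓ₂)
  (hblock : ∀ x y : ↥(R'.image (blk L)), blk n x.1 = blk n y.1 → |lam x - lam y| ≤ ℓ₃)

include hn hR' ha hs0 hs1 hℓ₁ hℓ₃ hbond hlap hblock in
/-- **(H-comm) FOR THE ψ-RESCALED TWO-CUTOFF OPERATOR, FREE OF `s`.**  For `a > 0`, `n ≥ 1`, `R′` a union of `nL`-blocks, `s ∈ [0,1]`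
and a coarse cut-off `λ` with bond ∕ Neumann-second-difference ∕ `n`-block oscillations `ℓ₁, ℓ₂, ℓ₃`:
`‖[diag(λ∘site), 𝒫♮(s)]w‖² ≤ α♮·⟨w,𝒫♮(s)w⟩ + β♮·‖w‖²` with
`α♮ = 2(12(d+1)n²ℓ₁² + L²·12(d+1)Ln²ℓ₁²)`, `β♮ = 2(3((n²ℓ₂)² + a²ℓ₃²) + 3((Ln²ℓ₂)² + a²ℓ₃²)) + 2θ²((1∕n)²D + (1∕n)⁴D′)`,
`θ = ℓ₁·8(d+1)(nL)²∕L^{d+1}`, `D = 2(d+1)L^{d+1}·2(d+1)`, `D′ = (2(d+1)L^{d+1})²`. [folklore] -/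
theorem comm_extLine_sq_le (w : Idx L R' → ℝ) :
    comm (fun c : Idx L R' => lam (site c)) (extLine (isBlockUnion_fine hR') n a s) *ᵥ w ⬝ᵥ
        comm (fun c : Idx L R' => lam (site c)) (extLine (isBlockUnion_fine hR') n a s) *ᵥ w ≤
      (2 * (12 * ((d : ℝ) + 1) * (n : ℝ) ^ 2 * ℓ₁ ^ 2 + (L : ℝ) ^ 2 * (12 * ((d : ℝ) + 1) * L * (n : ℝ) ^ 2 * ℓ₁ ^ 2))) *
          (w ⬝ᵥ (extLine (isBlockUnion_fine hR') n a s) *ᵥ w) +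
        (2 * (3 * (((n : ℝ) ^ 2 * ℓ₂) ^ 2 + a ^ 2 * ℓ₃ ^ 2) + 3 * (((L : ℝ) * (n : ℝ) ^ 2 * ℓ₂) ^ 2 + a ^ 2 * ℓ₃ ^ 2)) +
          2 * (ℓ₁ * (8 * ((d : ℝ) + 1) * ((n : ℝ) * L) ^ 2 / (L : ℝ) ^ (d + 1))) ^ 2 *
            ((1 / (n : ℝ)) ^ 2 * (2 * ((d : ℝ) + 1) * (L : ℝ) ^ (d + 1) * (2 * ((d : ℝ) + 1))) +
              ((1 / (n : ℝ)) ^ 2) ^ 2 * (2 * ((d : ℝ) + 1) * (L : ℝ) ^ (d + 1) * (2 * ((d : ℝ) + 1) * (L : ℝ) ^ (d + 1))))) *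
          (w ⬝ᵥ w) := by
  have hR'L : IsBlockUnion L R' := isBlockUnion_fine hR'
  have hRc : IsBlockUnion n (R'.image (blk L)) := isBlockUnion_coarse NeZero.one_le hR'
  set av := w ∘ Sum.inl with hav
  set ψ := w ∘ Sum.inr with hψ
  set K := comm (fun c : Idx L R' => lam (site c)) (runB hR'L n a) with hK
  set μ : ℝ := 1 / (n : ℝ) with hμ
  set θ : ℝ := ℓ₁ * (8 * ((d : ℝ) + 1) * ((n : ℝ) * L) ^ 2 / (L : ℝ) ^ (d + 1)) with hθ
  set αA : ℝ := 12 * ((d : ℝ) + 1) * (n : ℝ) ^ 2 * ℓ₁ ^ 2 with hαA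
  set βA : ℝ := 3 * (((n : ℝ) ^ 2 * ℓ₂) ^ 2 + a ^ 2 * ℓ₃ ^ 2) with hβA
  set αB : ℝ := 12 * ((d : ℝ) + 1) * L * (n : ℝ) ^ 2 * ℓ₁ ^ 2 with hαB
  set βB : ℝ := 3 * (((L : ℝ) * (n : ℝ) ^ 2 * ℓ₂) ^ 2 + a ^ 2 * ℓ₃ ^ 2) with hβB
  set D : ℝ := 2 * ((d : ℝ) + 1) * (L : ℝ) ^ (d + 1) * (2 * ((d : ℝ) + 1)) with hD
  set D' : ℝ := 2 * ((d : ℝ) + 1) * (L : ℝ) ^ (d + 1) * (2 * ((d : ℝ) + 1) * (L : ℝ) ^ (d + 1)) with hD'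
  -- the five pieces
  set u₁ := comm lam (runA n L a R') *ᵥ av with hu₁
  set u₂ := K.toBlocks₁₁ *ᵥ av with hu₂
  set u₃ := K.toBlocks₁₂ *ᵥ ψ with hu₃
  set u₄ := K.toBlocks₂₁ *ᵥ av with hu₄
  set u₅ := K.toBlocks₂₂ *ᵥ ψ with hu₅
  -- forms
  set FA := av ⬝ᵥ (runA n L a R') *ᵥ av with hFA
  set FB := av ⬝ᵥ (runB hR'L n a).toBlocks₁₁ *ᵥ av with hFB
  set G := Sum.elim (Real.sqrt s • av) (μ • ψ) ⬝ᵥ (runB hR'L n a) *ᵥ (Sum.elim (Real.sqrt s • av) (μ • ψ)) with hG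
  obtain ⟨hF, hFA0, hG0⟩ := extLine_form_split hn hR' ha hs0 w
  rw [← hav, ← hψ, ← hFA, ← hG] at hF
  -- (1) the pieces' bounds
  have h1 : u₁ ⬝ᵥ u₁ ≤ αA * FA + βA * (av ⬝ᵥ av) := by
    have h := comm_mulVec_sq_le_fineOpR hn hRc ha.le lam hℓ₁ hℓ₃ hbond hlap hblock av
    rw [hu₁, NE7K1LinWalkParametrix.comm, runA, hαA, hβA, hFA, runA]
    exact h
  have h2 : u₂ ⬝ᵥ u₂ ≤ αB * FB + βB * (av ⬝ᵥ av) := by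
    have h := comm_mulVec_sq_le_runB₁₁ hn hR' ha.le lam hℓ₁ hℓ₃ hbond hlap hblock av
    rw [hu₂, hK, toBlocks₁₁_comm, hαB, hβB, hFB]
    exact h
  have h3 : u₃ ⬝ᵥ u₃ ≤ θ ^ 2 * D * (ψ ⬝ᵥ ψ) := by
    have h := comm_toBlocks₁₂_sq_le hn hR' a hℓ₁ hbond ψ
    rw [hu₃, hK, hθ, hD]
    refine h.trans (le_of_eq ?_)
    ring
  have h4 : u₄ ⬝ᵥ u₄ ≤ θ ^ 2 * D * (av ⬝ᵥ av) := by
    have h := comm_toBlocks₂₁_sq_le hn hR' a hℓ₁ hbond av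
    rw [hu₄, hK, hθ, hD]
    refine h.trans (le_of_eq ?_)
    ring
  have h5 : u₅ ⬝ᵥ u₅ ≤ θ ^ 2 * D' * (ψ ⬝ᵥ ψ) := by
    have h := comm_toBlocks₂₂_sq_le hn hR' a hℓ₁ hbond ψ
    rw [hu₅, hK, hθ, hD']
    refine h.trans (le_of_eq ?_)
    ring
  -- (2) the row sums
  have hrows : comm (fun c : Idx L R' => lam (site c)) (extLine hR'L n a s) *ᵥ w ⬝ᵥ
      comm (fun c : Idx L R' => lam (site c)) (extLine hR'L n a s) *ᵥ w ≤
      2 * (1 - s) * (u₁ ⬝ᵥ u₁) + 2 * s * (u₂ ⬝ᵥ u₂) + 2 * (s * μ ^ 2) * (u₃ ⬝ᵥ u₃) +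
        (2 * (s * μ ^ 2) * (u₄ ⬝ᵥ u₄) + 2 * (μ ^ 2) ^ 2 * (u₅ ⬝ᵥ u₅)) := by
    have e : comm (fun c : Idx L R' => lam (site c)) (extLine hR'L n a s) *ᵥ w ⬝ᵥ
        comm (fun c : Idx L R' => lam (site c)) (extLine hR'L n a s) *ᵥ w =
        ∑ b : ↥(R'.image (blk L)), (comm (fun c : Idx L R' => lam (site c)) (extLine hR'L n a s) *ᵥ w) (Sum.inl b) ^ 2 +
          ∑ p : ↥(R'.image (blk L)) × NZ d L, (comm (fun c : Idx L R' => lam (site c)) (extLine hR'L n a s) *ᵥ w) (Sum.inr p) ^ 2 := by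
      simp only [dotProduct, Fintype.sum_sum_type, sq]
    rw [e]
    exact add_le_add (comm_extLine_inl_sq_le hR'L n a hs0 hs1 lam w) (comm_extLine_inr_sq_le hR'L n a hs0 lam w)
  -- (3) the form comparison `s·FB ≤ L²·G`, `(1−s)·FA = F − G`
  have hFB : s * FB ≤ (L : ℝ) ^ 2 * G := runB₁₁_form_le hn hR' ha hs0 av ψ
  have hav0 : 0 ≤ av ⬝ᵥ av := Finset.sum_nonneg fun i _ => mul_self_nonneg _
  have hψ0 : 0 ≤ ψ ⬝ᵥ ψ := Finset.sum_nonneg fun i _ => mul_self_nonneg _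
  have hww : w ⬝ᵥ w = av ⬝ᵥ av + ψ ⬝ᵥ ψ := by
    rw [hav, hψ, ← sumElim_dotProduct_sumElim, Sum.elim_comp_inl_inr]
  have hαA0 : 0 ≤ αA := by positivity
  have hαB0 : 0 ≤ αB := by positivity
  have hβA0 : 0 ≤ βA := by positivity
  have hβB0 : 0 ≤ βB := by positivity
  have hθD : 0 ≤ θ ^ 2 * D := by positivity
  have hθD' : 0 ≤ θ ^ 2 * D' := by positivity
  have hu3 : 0 ≤ u₃ ⬝ᵥ u₃ := Finset.sum_nonneg fun i _ => mul_self_nonneg _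
  have hu4 : 0 ≤ u₄ ⬝ᵥ u₄ := Finset.sum_nonneg fun i _ => mul_self_nonneg _
  have hu5 : 0 ≤ u₅ ⬝ᵥ u₅ := Finset.sum_nonneg fun i _ => mul_self_nonneg _
  -- the energy terms
  have hE : 2 * (1 - s) * (αA * FA) + 2 * s * (αB * FB) ≤ 2 * (αA + (L : ℝ) ^ 2 * αB) * (w ⬝ᵥ (extLine hR'L n a s) *ᵥ w) := by
    rw [hF]
    have e1 : 2 * s * (αB * FB) = 2 * αB * (s * FB) := by ring
    rw [e1]
    have h7 : 0 ≤ (1 - s) * FA := mul_nonneg (by linarith) hFA0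
    have p1 : 0 ≤ αA * G := mul_nonneg hαA0 hG0
    have p2 : 0 ≤ (L : ℝ) ^ 2 * (αB * ((1 - s) * FA)) := mul_nonneg (sq_nonneg _) (mul_nonneg hαB0 h7)
    have p3 : αB * (s * FB) ≤ αB * ((L : ℝ) ^ 2 * G) := mul_le_mul_of_nonneg_left hFB hαB0
    linarith [p1, p2, p3]
  -- the norm terms
  have hN : 2 * (1 - s) * (βA * (av ⬝ᵥ av)) + 2 * s * (βB * (av ⬝ᵥ av)) + 2 * (s * μ ^ 2) * (θ ^ 2 * D * (ψ ⬝ᵥ ψ)) +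
      (2 * (s * μ ^ 2) * (θ ^ 2 * D * (av ⬝ᵥ av)) + 2 * (μ ^ 2) ^ 2 * (θ ^ 2 * D' * (ψ ⬝ᵥ ψ))) ≤
      (2 * (βA + βB) + 2 * θ ^ 2 * (μ ^ 2 * D + (μ ^ 2) ^ 2 * D')) * (w ⬝ᵥ w) := by
    rw [hww]
    have hs1' : 0 ≤ 1 - s := by linarith
    have q1 : 0 ≤ s * (βA * (av ⬝ᵥ av)) := mul_nonneg hs0 (mul_nonneg hβA0 hav0)
    have q2 : 0 ≤ βA * (ψ ⬝ᵥ ψ) := mul_nonneg hβA0 hψ0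
    have q3 : 0 ≤ (1 - s) * (βB * (av ⬝ᵥ av)) := mul_nonneg hs1' (mul_nonneg hβB0 hav0)
    have q4 : 0 ≤ βB * (ψ ⬝ᵥ ψ) := mul_nonneg hβB0 hψ0
    have q5 : 0 ≤ (1 - s) * (μ ^ 2 * (θ ^ 2 * D * (av ⬝ᵥ av))) := mul_nonneg hs1' (mul_nonneg (sq_nonneg _) (mul_nonneg hθD hav0))
    have q6 : 0 ≤ (1 - s) * (μ ^ 2 * (θ ^ 2 * D * (ψ ⬝ᵥ ψ))) := mul_nonneg hs1' (mul_nonneg (sq_nonneg _) (mul_nonneg hθD hψ0))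
    have q7 : 0 ≤ (μ ^ 2) ^ 2 * (θ ^ 2 * D' * (av ⬝ᵥ av)) := mul_nonneg (sq_nonneg _) (mul_nonneg hθD' hav0)
    linarith [q1, q2, q3, q4, q5, q6, q7]
  -- assemble
  have hs1' : 0 ≤ 1 - s := by linarith
  calc comm (fun c : Idx L R' => lam (site c)) (extLine hR'L n a s) *ᵥ w ⬝ᵥ
        comm (fun c : Idx L R' => lam (site c)) (extLine hR'L n a s) *ᵥ w
      ≤ 2 * (1 - s) * (u₁ ⬝ᵥ u₁) + 2 * s * (u₂ ⬝ᵥ u₂) + 2 * (s * μ ^ 2) * (u₃ ⬝ᵥ u₃) +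
          (2 * (s * μ ^ 2) * (u₄ ⬝ᵥ u₄) + 2 * (μ ^ 2) ^ 2 * (u₅ ⬝ᵥ u₅)) := hrows
    _ ≤ 2 * (1 - s) * (αA * FA + βA * (av ⬝ᵥ av)) + 2 * s * (αB * FB + βB * (av ⬝ᵥ av)) +
          2 * (s * μ ^ 2) * (θ ^ 2 * D * (ψ ⬝ᵥ ψ)) +
          (2 * (s * μ ^ 2) * (θ ^ 2 * D * (av ⬝ᵥ av)) + 2 * (μ ^ 2) ^ 2 * (θ ^ 2 * D' * (ψ ⬝ᵥ ψ))) := by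
        gcongr
    _ = (2 * (1 - s) * (αA * FA) + 2 * s * (αB * FB)) +
          (2 * (1 - s) * (βA * (av ⬝ᵥ av)) + 2 * s * (βB * (av ⬝ᵥ av)) + 2 * (s * μ ^ 2) * (θ ^ 2 * D * (ψ ⬝ᵥ ψ)) +
            (2 * (s * μ ^ 2) * (θ ^ 2 * D * (av ⬝ᵥ av)) + 2 * (μ ^ 2) ^ 2 * (θ ^ 2 * D' * (ψ ⬝ᵥ ψ)))) := by ring
    _ ≤ 2 * (αA + (L : ℝ) ^ 2 * αB) * (w ⬝ᵥ (extLine hR'L n a s) *ᵥ w) +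
          (2 * (βA + βB) + 2 * θ ^ 2 * (μ ^ 2 * D + (μ ^ 2) ^ 2 * D')) * (w ⬝ᵥ w) := add_le_add hE hN

end Hcomm

end Summit.QuantumFields.BalabanUV.T4Continuum.NE7K1LinWalkLineHcomm

end
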